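import Mathlib
import Summits.Schanuel.Schanuel.Theorems.RigidCoreSchanuelOnLogFreeCorePiExpOfRe

/-!
# Line `sector-split` (v19) of crux `RigidCore.SchanuelOnLogFreeCore`: cells `(πi, u)`, `Re u ∈ ℚ*·π√d`

Crux `stmt-Schanuel-0970` (`Summit.Schanuel.Schanuel.Theses.RigidCore.SchanuelOnLogFreeCore`, (R):
Schanuel's conjecture for `ℚ`-free tuples from the log-free core `C_EA`), line `sector-split`,
skeleton v19 (lead c10).  This file proves calibration stub C10 `stub_cruxCell_piI_of_re_sqrt`:
GIVEN Nesterenko's theorem at every imaginary-axis CM point `τ = i√d` — `π ⊥ e^{π√d}` for all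
`d ≥ 1`, stub C9 `stub_nesterenkoImagAxis` of the skeleton, taken here as an explicit HYPOTHESIS —
every pair `x = (πi, u)` with `Re u = qπ√d`, `q ∈ ℚ*`, `d ≥ 1`, satisfies the conclusion of (R)
(indeed of Schanuel's conjecture, with no core and no linear-independence hypothesis):
`2 ≤ trdeg_ℚ ℚ(x 0, x 1, e^{x 0}, e^{x 1})`.

Device ("conjugate norms", verbatim the sibling file `…PiExpOfRe`, which is the case `d ∈ {1, 3}`
with the anchors supplied by the tree's `nesterenko_holds` / `nesterenko'_holds`): `ℚ(π)` is fixed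
pointwise by complex conjugation, so if `e^u` were algebraic over `ℚ(π)` then so would be
`conj (e^u) = e^{ū}` (`RelLWZeroOffAxes.isAlgebraic_adjoin_pi_conj`) and hence the conjugate norm
`e^u · e^{ū} = e^{2 Re u} = e^{2qc}`, `c = π√d` (`PiExpOfRe.exp_mul_exp_conj`).  Writing `q = m/n`,
`(e^{2qc})^n = (e^c)^{2m}` with `2m ≠ 0` (`PiExpOfRe.exp_two_mul_pow_den`), so `e^c` would be
algebraic over `ℚ(π)` (`PiExpOfRe.isAlgebraic_of_zpow`) — contradicting the hypothesis `π ⊥ e^{π√d}`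
(`LineDichotomy.transcendental_adjoin_of_algebraicIndependent_pair`).  The rank-2 cell then follows
from the plane bookkeeping of the sibling crux `SchanuelTwo` (`two_le_trdeg_SF_of_isAlgebraic_pair`:
two algebraically independent numbers algebraic over `K_x = ℚ(x, e^x)` force `trdeg K_x ≥ 2`; here
`π`, a root of `X² + (πi)²`, and `e^u ∈ K_x`).

New settled cells once C9 lands (all with the hypothesis kept explicit here): `π ⊥ e^{π√2 + i}`,
`π ⊥ e^{π√d + iy}` (`d ≥ 1`, `y ∈ ℝ`), the core pairs `(πi, π√2 + i)` and `(πi, π√7/3 + i)`.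

## References

* [NesterenkoPhilippon2001] Yu. V. Nesterenko, P. Philippon (eds.), *Introduction to Algebraic
  Independence Theory*, LNM 1752 (2001): Ch. 1 §3 Corollary 3.2 (PDF p. 19) — for every positive
  integer `d`, `π` and `e^{π√d}` are algebraically independent over `ℚ`.
-/

noncomputable section

-- `Summit.Schanuel.Schanuel.…` is the D-0017 single-problem layout
set_option linter.dupNamespace false

namespace Summit.Schanuel.Schanuel.Theorems.RigidCore

open IntermediateField
open Literature.NumberTheory.Transcendental
open Literature.NumberTheory.Transcendental.Specialization
open PiExpOfRe RelLWZeroOffAxes LineDichotomy CalibrationR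

namespace PiExpOfReSqrt

/-! ## Helper: `π ⊥ e^u` for `Re u ∈ ℚ*·π√d`, given `π ⊥ e^{π√d}` -/

/-- **`π ⊥ e^u` for `Re u ∈ ℚ*·π√d` (conditional on Nesterenko at `τ = i√d`).**  Assume that `π`
and `e^{π√d}` are algebraically independent for every `d ≥ 1`.  Then for every `d ≥ 1`, every
nonzero rational `q` and every `u : ℂ` with `Re u = qπ√d`, `π` and `e^u` are algebraically
independent over `ℚ`.  Proof: if not, `e^u` is algebraic over `ℚ(π)` (`π` being transcendental),
hence so is `e^{ū} = conj(e^u)` (`ℚ(π)` is conj-fixed) and the conjugate norm `e^{2 Re u}`; then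
`(e^{2 Re u})^{den q} = (e^{π√d})^{2 num q}` makes `e^{π√d}` algebraic over `ℚ(π)`, contradicting
the hypothesis at `d`.
[cite: NesterenkoPhilippon2001, Ch. 1 §3 Corollary 3.2 (PDF p. 19)] -/
theorem algebraicIndependent_pi_exp_of_re_sqrt
    (hN : ∀ d : ℕ, d ≠ 0 →
      AlgebraicIndependent ℚ ![(Real.pi : ℂ), Complex.exp ((Real.pi * Real.sqrt d : ℝ) : ℂ)])
    (d : ℕ) (q : ℚ) (u : ℂ) (hd : d ≠ 0) (hq : q ≠ 0)
    (hre : u.re = q * (Real.pi * Real.sqrt d)) :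
    AlgebraicIndependent ℚ ![(Real.pi : ℂ), Complex.exp u] := by
  have hz := hN d hd
  by_contra hnot
  set F : IntermediateField ℚ ℂ := adjoin ℚ ({(Real.pi : ℂ)} : Set ℂ) with hF
  -- `e^u` is algebraic over `ℚ(π)`
  have h1 : IsAlgebraic F (Complex.exp u) := by
    rw [hF, IntermediateField.isAlgebraic_adjoin_iff]
    exact isAlgebraic_adjoin_of_not_algebraicIndependent transcendental_pi_complex hnot
  -- hence so is `e^{ū} = conj (e^u)` (conjugation fixes `ℚ(π)`)
  have h2 : IsAlgebraic F (Complex.exp ((starRingEnd ℂ) u)) := by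
    rw [Complex.exp_conj]
    exact isAlgebraic_adjoin_pi_conj h1
  -- and the conjugate norm `e^{2 Re u}`
  have h3 : IsAlgebraic F (Complex.exp (2 * (u.re : ℂ))) := by
    rw [← exp_mul_exp_conj]
    exact h1.mul h2
  -- `(e^{2 Re u})^{den q} = (e^{π√d})^{2 num q}`, so `e^{π√d}` is algebraic over `ℚ(π)`
  have h4 : IsAlgebraic F (Complex.exp ((Real.pi * Real.sqrt d : ℝ) : ℂ)) := by
    have hpow :
        IsAlgebraic F (Complex.exp ((Real.pi * Real.sqrt d : ℝ) : ℂ) ^ (2 * q.num)) := by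
      rw [← exp_two_mul_pow_den hre]
      exact h3.pow _
    exact isAlgebraic_of_zpow (mul_ne_zero two_ne_zero (Rat.num_ne_zero.2 hq)) hpow
  -- contradiction with the hypothesis: `e^{π√d}` is transcendental over `ℚ(π)`
  exact (transcendental_adjoin_of_algebraicIndependent_pair hz).1 h4

end PiExpOfReSqrt

open PiExpOfReSqrt

/-! ## Stub C10: the rank-2 cells `x = (πi, u)`, `Re u ∈ ℚ*·π√d`, of (R) / Schanuel -/

/-- **Stub `stub_cruxCell_piI_of_re_sqrt` of line `sector-split` (v19, C10; registered signature).**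
Assume (stub C9, Nesterenko 1996 at `τ = i√d`) that `π` and `e^{π√d}` are algebraically independent
for every `d ≥ 1`.  Then for `x : Fin 2 → ℂ` with `x 0 = πi` and `Re (x 1) = qπ√d`, `q ∈ ℚ*`,
`d ≥ 1`, `2 ≤ trdeg_ℚ ℚ(x 0, x 1, e^{x 0}, e^{x 1})` — the conclusion of (R) (and of Schanuel) at
`x`, with no core and no linear-independence hypothesis: `π` is algebraic over `K_x` (a root of
`X² + (x 0)²`), `e^{x 1} ∈ K_x`, and `π ⊥ e^{x 1}` by `algebraicIndependent_pi_exp_of_re_sqrt`; two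
algebraically independent numbers algebraic over `K_x` give `trdeg K_x ≥ 2`
(`two_le_trdeg_SF_of_isAlgebraic_pair`).
[cite: NesterenkoPhilippon2001, Ch. 1 §3 Corollary 3.2 (PDF p. 19)] -/
theorem stub_cruxCell_piI_of_re_sqrt :
    (∀ d : ℕ, d ≠ 0 →
      AlgebraicIndependent ℚ ![(Real.pi : ℂ), Complex.exp ((Real.pi * Real.sqrt d : ℝ) : ℂ)]) →
    ∀ (d : ℕ) (q : ℚ) (x : Fin 2 → ℂ), d ≠ 0 → q ≠ 0 → x 0 = ↑Real.pi * Complex.I →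
      (x 1).re = q * (Real.pi * Real.sqrt d) →
      ((2 : ℕ) : Cardinal) ≤ Algebra.trdeg ℚ
        ↥(IntermediateField.adjoin ℚ (Set.range x ∪ Set.range (Complex.exp ∘ x))) := by
  intro hN d q x hd hq h0 hre
  have hind := algebraicIndependent_pi_exp_of_re_sqrt hN d q (x 1) hd hq hre
  set K : IntermediateField ℚ ℂ := adjoin ℚ (Set.range x ∪ Set.range (Complex.exp ∘ x)) with hK
  -- `x 0 = πi ∈ K`, so `π` is a root of `X² + (x 0)²` over `K`
  have hx0 : x 0 ∈ K := subset_adjoin ℚ _ (Or.inl ⟨0, rfl⟩)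
  have hπ : IsAlgebraic K (Real.pi : ℂ) := by
    refine ⟨Polynomial.X ^ 2 + Polynomial.C (⟨x 0, hx0⟩ ^ 2), ?_, ?_⟩
    · exact (Polynomial.monic_X_pow_add_C _ two_ne_zero).ne_zero
    · simp only [map_add, map_pow, Polynomial.aeval_X, Polynomial.aeval_C,
        IntermediateField.algebraMap_apply]
      rw [h0]
      ring_nf
      rw [Complex.I_sq]
      ring
  -- `e^{x 1} ∈ K`
  have he : IsAlgebraic K (Complex.exp (x 1)) :=
    isAlgebraic_algebraMap (⟨Complex.exp (x 1), subset_adjoin ℚ _ (Or.inr ⟨1, rfl⟩)⟩ : K)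
  have h := two_le_trdeg_SF_of_isAlgebraic_pair x hind hπ he
  exact_mod_cast h

/-! ## Cells (hypothesis C9 kept explicit) -/

/-- Cell: `π ⊥ e^{π√d + iy}` for every `d ≥ 1` and every real `y`, given Nesterenko at `τ = i√d`.
[cite: NesterenkoPhilippon2001, Ch. 1 §3 Corollary 3.2 (PDF p. 19)] -/
theorem PiExpOfReSqrt.algebraicIndependent_pi_exp_pi_sqrt_add
    (hN : ∀ d : ℕ, d ≠ 0 →
      AlgebraicIndependent ℚ ![(Real.pi : ℂ), Complex.exp ((Real.pi * Real.sqrt d : ℝ) : ℂ)])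
    (d : ℕ) (hd : d ≠ 0) (y : ℝ) :
    AlgebraicIndependent ℚ
      ![(Real.pi : ℂ), Complex.exp (↑(Real.pi * Real.sqrt d) + ↑y * Complex.I)] := by
  have h : (↑(Real.pi * Real.sqrt d) + ↑y * Complex.I : ℂ).re =
      ((1 : ℚ) : ℝ) * (Real.pi * Real.sqrt d) := by simp
  exact algebraicIndependent_pi_exp_of_re_sqrt hN d 1 _ hd one_ne_zero h

/-- Cell: `π ⊥ e^{π√2 + i}`, given Nesterenko at `τ = i√d`.
[cite: NesterenkoPhilippon2001, Ch. 1 §3 Corollary 3.2 (PDF p. 19)] -/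
theorem PiExpOfReSqrt.algebraicIndependent_pi_exp_pi_sqrt_two_add_I
    (hN : ∀ d : ℕ, d ≠ 0 →
      AlgebraicIndependent ℚ ![(Real.pi : ℂ), Complex.exp ((Real.pi * Real.sqrt d : ℝ) : ℂ)]) :
    AlgebraicIndependent ℚ
      ![(Real.pi : ℂ), Complex.exp (↑(Real.pi * Real.sqrt 2) + Complex.I)] := by
  have h : (↑(Real.pi * Real.sqrt 2) + Complex.I : ℂ).re =
      ((1 : ℚ) : ℝ) * (Real.pi * Real.sqrt (2 : ℕ)) := by simp
  exact algebraicIndependent_pi_exp_of_re_sqrt hN 2 1 _ two_ne_zero one_ne_zero h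

/-- Cell of (R): the core pair `(πi, π√2 + i)` — `trdeg ℚ(πi, π√2 + i, −1, e^{π√2 + i}) ≥ 2`,
given Nesterenko at `τ = i√d` (used at `d = 2`).
[cite: NesterenkoPhilippon2001, Ch. 1 §3 Corollary 3.2 (PDF p. 19)] -/
theorem PiExpOfReSqrt.cruxCell_piI_pi_sqrt_two_add_I
    (hN : ∀ d : ℕ, d ≠ 0 →
      AlgebraicIndependent ℚ ![(Real.pi : ℂ), Complex.exp ((Real.pi * Real.sqrt d : ℝ) : ℂ)]) :
    ((2 : ℕ) : Cardinal) ≤ Algebra.trdeg ℚ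
      ↥(IntermediateField.adjoin ℚ
        (Set.range ![↑Real.pi * Complex.I, ↑(Real.pi * Real.sqrt 2) + Complex.I] ∪
          Set.range
            (Complex.exp ∘ ![↑Real.pi * Complex.I, ↑(Real.pi * Real.sqrt 2) + Complex.I]))) := by
  refine stub_cruxCell_piI_of_re_sqrt hN 2 1 _ two_ne_zero one_ne_zero rfl ?_
  simp

/-- Cell of (R): the core pair `(πi, π√7/3 + i)` — `trdeg ℚ(πi, π√7/3 + i, −1, e^{π√7/3 + i}) ≥ 2`,
given Nesterenko at `τ = i√d` (used at `d = 7`, `q = 1/3`).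
[cite: NesterenkoPhilippon2001, Ch. 1 §3 Corollary 3.2 (PDF p. 19)] -/
theorem PiExpOfReSqrt.cruxCell_piI_pi_sqrt_seven_div_three_add_I
    (hN : ∀ d : ℕ, d ≠ 0 →
      AlgebraicIndependent ℚ ![(Real.pi : ℂ), Complex.exp ((Real.pi * Real.sqrt d : ℝ) : ℂ)]) :
    ((2 : ℕ) : Cardinal) ≤ Algebra.trdeg ℚ
      ↥(IntermediateField.adjoin ℚ
        (Set.range ![↑Real.pi * Complex.I, ↑(Real.pi * Real.sqrt 7) / 3 + Complex.I] ∪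
          Set.range (Complex.exp ∘
            ![↑Real.pi * Complex.I, ↑(Real.pi * Real.sqrt 7) / 3 + Complex.I]))) := by
  refine stub_cruxCell_piI_of_re_sqrt hN 7 (1 / 3) _ (by norm_num) (by norm_num) rfl ?_
  simp only [Matrix.cons_val_one, Matrix.cons_val_fin_one, Complex.add_re, Complex.I_re, add_zero]
  rw [Complex.div_re]
  simp
  ring

end Summit.Schanuel.Schanuel.Theorems.RigidCore

end
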